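import Mathlib
import Literature.Analysis.FluidPDE.LeraySelfSimilarCalculus
import Literature.Analysis.FluidPDE.AncientSimilarityVorticity
import Literature.Analysis.FluidPDE.SwirlMaximumPrinciple
import Literature.Analysis.FluidPDE.FlatSwirlGauge
import Summits.NavierStokesRegularity.OSWSelfSimilar.TypeIIModulatedAnsatz
import HarnessLib
/-!
# Scaling weights of the modulated ansatz, the vorticity of `ΛV`, and the swirl HARD CONSTRAINT as a corollary of
# the tree's DISCHARGED maximum principle (zone Z1 TEMPLATE §T1.0 (E2) weight rule, §T1.1 (E5)/(E6), §T1.4-III (C7), null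
# test n4 — kernel-checked)

HONEST FRAMING (cell ns-blowup GROUP B «PROFILE SEARCH», zone Z1 «Type-II log-modulated DSS ansatz for axisymmetric
Navier–Stokes — the template IS the deliverable»; D-0035/D-0074): part V of the Z1 dictionary (parts I–IV:
`TypeIIModulationDictionary`, `TypeIIModulationLawClasses`, `TypeIIModulatedAnsatz`, `TypeIIModulatedEnergy`).

1. **The weight rule** (TEMPLATE (E2), last sentence): a physical quantity of scaling weight `k`,
   `F_phys(x, t) = λ(t)⁻ᵏ F(τ(t), (x − x*(t))/λ(t))`, has
   `∂ₜF_phys = λ⁻ᵏ⁻²[∂_τF + a (kF + y·∇F) + ζ·∇F]`, `a = −λλ̇`, `ζ = −λẋ*` — `hasDerivAt_modulatedAnsatz_time_weight`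
   (`k = 1` is part III's `hasDerivAt_modulatedAnsatz_time`, verbatim; `k = 2`: vorticity, pressure, Hou–Li `u₁`; `k = 3`: Hou–Li
   `ω₁`; `k = 0`: the swirl `Γ = r u^θ`, `hasDerivAt_modulatedAnsatz_time_weightZero` — NO zeroth-order modulation term,
   which is why the modulated swirl equation (E5) stays a drift–diffusion equation and keeps its maximum principle).
2. **Weight 2 = vorticity** (TEMPLATE (E2)/(E6)): `curl (k • U(c ·)) = (k c) • (curl U)(c ·)` (the tree's
   `Literature.Analysis.FluidPDE.curl_smul_comp_smul`), so `ω = curl u = λ⁻² (curl V)(y)` for the modulated ansatz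
   (`curl_modulatedAnsatz`), and the modulation acts on the
   vorticity through `curl ΛV = 2Ω + y·∇Ω`, `Ω = curl V` (`curl_add_fderiv_apply_self`, from the tree's
   `Literature.Analysis.FluidPDE.curl_fderiv_apply_self`).
3. **Weight 0 = the swirl, and null test n4 / (C7) AS A COROLLARY OF A DISCHARGED TREE THEOREM.** For a centre `x*` ON
   THE AXIS the rescaled swirl `G := swirl V` of `V(y) = λ u(x* + λy)` IS the physical swirl: `G(y) = Γ(x* + λy)`
   (`swirl_smul_comp_axisAffine`, `swirl_modulatedAnsatz`). TEMPLATE (E5) wrote that the maximum principle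
   `sup|Γ(t)| ≤ ‖Γ₀‖_∞` was «typed only as a route-file Prop, not a discharged theorem»; since 2026-08-26 the tree
   DISCHARGES it: `Literature.Analysis.FluidPDE.abs_swirl_le_of_classical` (Lei–Zhang 2017 (1.4); KNSS 2009 (1.9)), from
   the swirl equation `Literature.Analysis.FluidPDE.swirl_transport_holds` (= (E5) at `a = ζ = 0`). Hence the template's
   HARD CONSTRAINT holds in EVERY gauge: `|G(y, τ)| ≤ M` for every `λ ≠ 0`, every axis point `x*`, every `y`
   (`abs_swirl_modulatedProfile_le`; Tao class: `abs_swirl_modulatedProfile_le_of_isTaoSolutionOn`), and off the axis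
   `|V^θ(y)| ≤ M / r_y` (`abs_swirlVelocity_modulatedProfile_le`) — CITED, not restated.

**Nothing here is a statement that a Navier–Stokes solution blows up or stays regular**: items 1–2 are chain-rule
identities valid for every differentiable field and every nonzero scale; item 3 applies an existing tree theorem to a
rescaled copy of a given classical solution. «violates: n/a — dictionary»; bears_on LADDER-NS N5/Z1 → N1 linear core / N0⁻.
Author: ns-blowup-profile-eng-1 g5, 2026-08-27.
-/

open Real Filter Topology Set InnerProductSpace
open scoped Laplacian RealInnerProductSpace
open Literature.Analysis.FluidPDE

namespace Summit.NavierStokesRegularity.OSWSelfSimilar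
namespace TypeIIModulationDictionary

/-! ### 1. The weight rule -/

section Weight

variable {E : Type*} [NormedAddCommGroup E] [NormedSpace ℝ E]
variable {F : Type*} [NormedAddCommGroup F] [NormedSpace ℝ F]

/-- **TEMPLATE (E2), the weight rule.** Let `λ` have derivative `λ̇` at `t` with `λ(t) ≠ 0`, the clock `τ` have
derivative `λ(t)⁻²` at `t`, the centre `x*` have derivative `ẋ*` at `t`, and `F : ℝ × E → F` be Fréchet-differentiable
at `(τ(t), y)`, `y := λ(t)⁻¹ • (x − x*(t))`, with derivative `L`. Then for every weight `k : ℕ` the quantity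
`s ↦ λ(s)⁻ᵏ • F(τ(s), λ(s)⁻¹ • (x − x*(s)))` has time derivative
`λ(t)⁻ᵏ⁻² • (L(1,0) + (−λλ̇) • (k • F(τ,y) + L(0,y)) + L(0, (−λ) • ẋ*))` at `t`, i.e.
`∂ₜ(λ⁻ᵏF) = λ⁻ᵏ⁻²[∂_τF + a(kF + y·∇F) + ζ·∇F]` with `a = −λλ̇`, `ζ = −λẋ*`. [new here — dictionary] -/
theorem hasDerivAt_modulatedAnsatz_time_weight {lam τc : ℝ → ℝ} {xc : ℝ → E} {V : ℝ × E → F}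
    {L : ℝ × E →L[ℝ] F} {dlam : ℝ} {dxc : E} {t : ℝ} {x : E} (k : ℕ)
    (hlam : HasDerivAt lam dlam t) (hne : lam t ≠ 0) (hτ : HasDerivAt τc ((lam t)⁻¹ ^ 2) t)
    (hxc : HasDerivAt xc dxc t) (hV : HasFDerivAt V L (τc t, (lam t)⁻¹ • (x - xc t))) :
    HasDerivAt (fun s => (lam s)⁻¹ ^ k • V (τc s, (lam s)⁻¹ • (x - xc s)))
      ((lam t)⁻¹ ^ (k + 2) • (L (1, 0)
        + (-(lam t * dlam)) • ((k : ℝ) • V (τc t, (lam t)⁻¹ • (x - xc t)) + L (0, (lam t)⁻¹ • (x - xc t)))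
        + L (0, (-lam t) • dxc))) t := by
  have h_inv : HasDerivAt (fun s => (lam s)⁻¹) (-dlam / (lam t) ^ 2) t := hlam.inv hne
  have h_pow : HasDerivAt (fun s => (lam s)⁻¹ ^ k)
      ((k : ℝ) * (lam t)⁻¹ ^ (k - 1) * (-dlam / (lam t) ^ 2)) t := h_inv.pow k
  have h_sub : HasDerivAt (fun s => x - xc s) (-dxc) t := hxc.const_sub x
  have h_y : HasDerivAt (fun s => (lam s)⁻¹ • (x - xc s))
      ((lam t)⁻¹ • (-dxc) + (-dlam / (lam t) ^ 2) • (x - xc t)) t := h_inv.smul h_sub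
  have h_in : HasDerivAt (fun s => (τc s, (lam s)⁻¹ • (x - xc s)))
      ((lam t)⁻¹ ^ 2, (lam t)⁻¹ • (-dxc) + (-dlam / (lam t) ^ 2) • (x - xc t)) t := hτ.prodMk h_y
  have h_comp : HasDerivAt (fun s => V (τc s, (lam s)⁻¹ • (x - xc s)))
      (L ((lam t)⁻¹ ^ 2, (lam t)⁻¹ • (-dxc) + (-dlam / (lam t) ^ 2) • (x - xc t))) t :=
    hV.comp_hasDerivAt t h_in
  have h_all := h_pow.smul h_comp
  refine h_all.congr_deriv ?_
  -- linearity bookkeeping for `L`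
  have hsplit : ∀ (r : ℝ) (w : E), L (r, w) = r • L (1, 0) + L (0, w) := by
    intro r w
    rw [← map_smul, ← map_add]
    congr 1
    ext <;> simp
  have hL0add : ∀ w w' : E, L (0, w + w') = L (0, w) + L (0, w') := by
    intro w w'
    rw [← map_add, Prod.mk_add_mk, add_zero]
  have hL0smul : ∀ (c : ℝ) (w : E), L (0, c • w) = c • L (0, w) := by
    intro c w
    rw [← map_smul, Prod.smul_mk, smul_zero]
  have hyder : (lam t)⁻¹ • (-dxc) + (-dlam / (lam t) ^ 2) • (x - xc t)
      = (-(lam t)⁻¹) • dxc + (-dlam / lam t) • ((lam t)⁻¹ • (x - xc t)) := by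
    rw [smul_smul, smul_neg, neg_smul]
    congr 1
    field_simp
  rw [hyder, hsplit]
  simp only [hL0add, hL0smul]
  -- the scalar prefactor of the `F` term: `k λ^{-(k-1)} (−λ̇/λ²) = λ^{−k−2} (−λλ̇) k`
  cases k with
  | zero =>
    simp only [pow_zero, Nat.cast_zero, zero_mul, zero_smul, zero_add, one_smul]
    match_scalars <;> field_simp
  | succ j =>
    simp only [Nat.add_sub_cancel, Nat.cast_add, Nat.cast_one, inv_pow]
    match_scalars <;> field_simp <;> ring

/-- **TEMPLATE (E2), weight 0 (the swirl `Γ = r u^θ`, `G(y, τ) = Γ(x, t)`): NO zeroth-order modulation term.** With the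
data of `hasDerivAt_modulatedAnsatz_time_weight`, `s ↦ F(τ(s), λ(s)⁻¹ • (x − x*(s)))` has time derivative
`λ(t)⁻² • (L(1,0) + (−λλ̇) • L(0,y) + L(0,(−λ) • ẋ*))`, i.e. `∂ₜF_phys = λ⁻²[∂_τF + a y·∇F + ζ·∇F]` — pure transport.
This is why the modulated swirl equation (E5) has no zeroth-order term and keeps the maximum principle (item 3 below).
[new here — dictionary] -/
theorem hasDerivAt_modulatedAnsatz_time_weightZero {lam τc : ℝ → ℝ} {xc : ℝ → E} {V : ℝ × E → F}
    {L : ℝ × E →L[ℝ] F} {dlam : ℝ} {dxc : E} {t : ℝ} {x : E}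
    (hlam : HasDerivAt lam dlam t) (hne : lam t ≠ 0) (hτ : HasDerivAt τc ((lam t)⁻¹ ^ 2) t)
    (hxc : HasDerivAt xc dxc t) (hV : HasFDerivAt V L (τc t, (lam t)⁻¹ • (x - xc t))) :
    HasDerivAt (fun s => V (τc s, (lam s)⁻¹ • (x - xc s)))
      ((lam t)⁻¹ ^ 2 • (L (1, 0)
        + (-(lam t * dlam)) • L (0, (lam t)⁻¹ • (x - xc t))
        + L (0, (-lam t) • dxc))) t := by
  have h := hasDerivAt_modulatedAnsatz_time_weight 0 hlam hne hτ hxc hV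
  simp only [pow_zero, one_smul, Nat.cast_zero, zero_smul, zero_add] at h
  exact h

end Weight

/-! ### 2. Weight 2: the vorticity of a dilated field and of `ΛV` -/

section Vorticity

/-- **TEMPLATE (E2)/(E6): vorticity has weight 2.** For the centred modulated ansatz at a frozen time,
`u(z) = λ⁻¹ • V(λ⁻¹ • z)`: `curl u (x) = λ⁻² • (curl V)(λ⁻¹ • x)`, i.e. `ω = λ⁻² Ω(y)`, `Ω := curl V` (the tree's
`Literature.Analysis.FluidPDE.curl_smul_comp_smul` with `k = c = λ⁻¹`). [new here — dictionary] -/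
theorem curl_modulatedAnsatz (V : (EuclideanSpace ℝ (Fin 3)) → (EuclideanSpace ℝ (Fin 3))) (lam : ℝ) (x : (EuclideanSpace ℝ (Fin 3))) :
    curl (fun z => lam⁻¹ • V (lam⁻¹ • z)) x = lam⁻¹ ^ 2 • curl V (lam⁻¹ • x) := by
  rw [curl_smul_comp_smul, sq]

/-- **TEMPLATE (E2): `curl ΛV = 2Ω + y·∇Ω`** (`ΛV = V + y·∇V`, `Ω = curl V`, `V ∈ C²`): the modulation term acts on the
vorticity with weight 2. One line from the tree's `curl_fderiv_apply_self` (`curl (y·∇V) = curl V + y·∇ curl V`).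
[new here — dictionary] -/
theorem curl_add_fderiv_apply_self {V : (EuclideanSpace ℝ (Fin 3)) → (EuclideanSpace ℝ (Fin 3))} (hV : ContDiff ℝ 2 V) (x : (EuclideanSpace ℝ (Fin 3))) :
    curl (fun y => V y + fderiv ℝ V y y) x = (2 : ℝ) • curl V x + fderiv ℝ (curl V) x x := by
  have hd : DifferentiableAt ℝ V x := (hV.differentiable two_ne_zero) x
  have hD : DifferentiableAt ℝ (fun y => fderiv ℝ V y y) x :=
    ((((hV.fderiv_right (m := 1) (by norm_num)).differentiable one_ne_zero) x)).clm_apply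
      differentiableAt_id
  rw [curl_add hd hD, curl_fderiv_apply_self hV x, two_smul]
  abel

end Vorticity

/-! ### 3. Weight 0: the swirl, and the HARD CONSTRAINT n4 / (C7) from the tree's discharged maximum principle -/

section Swirl

/-- **The swirl has weight 0** (TEMPLATE (E2): `Γ = r u^θ`, `k = 0`; (E5): `G := r V^θ = Γ(x, t)` identically). For a
centre `x*` ON THE AXIS (`x*₀ = x*₁ = 0`) and any scale `λ`, the swirl of the rescaled field `V(y) = λ • u(x* + λ • y)` at
`y` equals the swirl of `u` at `x = x* + λ • y`: `swirl V y = swirl u (x* + λ • y)` (the factor `λ` of the amplitude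
cancels the factor `λ⁻¹` of the cylindrical radius; no hypothesis on `λ`). [new here — dictionary] -/
theorem swirl_smul_comp_axisAffine (u : (EuclideanSpace ℝ (Fin 3)) → (EuclideanSpace ℝ (Fin 3))) {xc : (EuclideanSpace ℝ (Fin 3))} (hxc0 : xc 0 = 0) (hxc1 : xc 1 = 0) (lam : ℝ)
    (y : (EuclideanSpace ℝ (Fin 3))) : swirl (fun w => lam • u (xc + lam • w)) y = swirl u (xc + lam • y) := by
  simp only [swirl, PiLp.smul_apply, PiLp.add_apply, smul_eq_mul, hxc0, hxc1, zero_add]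
  ring

/-- **The swirl of the modulated ansatz** (TEMPLATE (E1) at a frozen time, centre on the axis; any `λ`, the identity
is trivial at `λ = 0`): for `u(x) = λ⁻¹ • V(λ⁻¹ • (x − x*))`, `swirl u x = swirl V (λ⁻¹ • (x − x*))` — `Γ(x, t) = G(y, τ)`.
[new here — dictionary] -/
theorem swirl_modulatedAnsatz (V : (EuclideanSpace ℝ (Fin 3)) → (EuclideanSpace ℝ (Fin 3))) {xc : (EuclideanSpace ℝ (Fin 3))} (hxc0 : xc 0 = 0) (hxc1 : xc 1 = 0) (lam : ℝ)
    (x : (EuclideanSpace ℝ (Fin 3))) :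
    swirl (fun z => lam⁻¹ • V (lam⁻¹ • (z - xc))) x = swirl V (lam⁻¹ • (x - xc)) := by
  simp only [swirl, PiLp.smul_apply, PiLp.sub_apply, smul_eq_mul, hxc0, hxc1, sub_zero]
  ring

/-- **TEMPLATE null test n4 / (C7) — the swirl HARD CONSTRAINT, in every gauge, as a corollary of the tree's DISCHARGED
maximum principle `Literature.Analysis.FluidPDE.abs_swirl_le_of_classical`** (Lei–Zhang 2017 (1.4); KNSS 2009 (1.9);
Chae–Lee 2002). Let `(v, q)` be a classical solution of the unforced Navier–Stokes system (`ν > 0`) on `[0, T] × (EuclideanSpace ℝ (Fin 3))` with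
bounded (`|v| ≤ V₀`) axisymmetric velocity and `|Γ₀| ≤ M`. Then for every time `t ∈ [0, T]`, every scale `λ`, every
centre `x*` on the axis and every `y`, the rescaled profile `V(y) = λ • v(t, x* + λ • y)` satisfies `|swirl V y| ≤ M`:
`sup_y |G(y, τ)| ≤ ‖Γ₀‖_∞` for all `τ`, whatever the gauge `(λ(t), x*(t))`. CITED, not restated: the proof is
`swirl_smul_comp_axisAffine` + the tree theorem. [new here — dictionary] -/
theorem abs_swirl_modulatedProfile_le {T ν V₀ M : ℝ} {v : ℝ → (EuclideanSpace ℝ (Fin 3)) → (EuclideanSpace ℝ (Fin 3))} {q : ℝ → (EuclideanSpace ℝ (Fin 3)) → ℝ}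
    (hν : 0 < ν) (hT : 0 < T) (hcl : IsClassicalNSSolutionOn (Icc 0 T) ν 0 v q)
    (haxi : ∀ t ∈ Icc 0 T, IsAxisymmetric (v t)) (hV : ∀ t ∈ Icc 0 T, ∀ x, ‖v t x‖ ≤ V₀)
    (hM : ∀ x, |swirl (v 0) x| ≤ M) {t : ℝ} (ht : t ∈ Icc 0 T) (lam : ℝ) {xc : (EuclideanSpace ℝ (Fin 3))} (hxc0 : xc 0 = 0)
    (hxc1 : xc 1 = 0) (y : (EuclideanSpace ℝ (Fin 3))) :
    |swirl (fun w => lam • v t (xc + lam • w)) y| ≤ M := by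
  rw [swirl_smul_comp_axisAffine (v t) hxc0 hxc1 lam y]
  exact abs_swirl_le_of_classical hν hT hcl haxi hV hM t ht (xc + lam • y)

/-- **The same in Tao's class** (`Literature.Analysis.FluidPDE.IsTaoSolutionOn.abs_swirl_le`: the velocity bound is
automatic there): for a Tao-class solution on `[0, T]` (`ν > 0`, `T > 0`) with axisymmetric slices and `|Γ₀| ≤ M`, every
rescaled profile `V(y) = λ • v(t, x* + λ • y)` (`t ∈ [0, T]`, `x*` on the axis) has `|swirl V y| ≤ M`. [new here — dictionary] -/
theorem abs_swirl_modulatedProfile_le_of_isTaoSolutionOn {T ν M : ℝ} {u₀ : (EuclideanSpace ℝ (Fin 3)) → (EuclideanSpace ℝ (Fin 3))} {v : ℝ → (EuclideanSpace ℝ (Fin 3)) → (EuclideanSpace ℝ (Fin 3))}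
    {q : ℝ → (EuclideanSpace ℝ (Fin 3)) → ℝ} (h : IsTaoSolutionOn T ν u₀ v q) (hν : 0 < ν) (hT : 0 < T)
    (haxi : ∀ t ∈ Icc 0 T, IsAxisymmetric (v t)) (hM : ∀ x, |swirl u₀ x| ≤ M) {t : ℝ} (ht : t ∈ Icc 0 T)
    (lam : ℝ) {xc : (EuclideanSpace ℝ (Fin 3))} (hxc0 : xc 0 = 0) (hxc1 : xc 1 = 0) (y : (EuclideanSpace ℝ (Fin 3))) :
    |swirl (fun w => lam • v t (xc + lam • w)) y| ≤ M := by
  rw [swirl_smul_comp_axisAffine (v t) hxc0 hxc1 lam y]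
  exact h.abs_swirl_le hν hT haxi hM t ht (xc + lam • y)

/-- **TEMPLATE n4 in the swirl-velocity form `|V^θ(y, τ)| ≤ ‖Γ₀‖_∞ / r_y` off the axis** (TEMPLATE (E5), last sentence):
under the hypotheses of `abs_swirl_modulatedProfile_le`, at every `y` with `r_y ≠ 0` the rescaled swirl VELOCITY of
`V(y) = λ • v(t, x* + λ • y)` obeys `|swirlVelocity V y| ≤ M / cylRadius y` (the tree's
`swirl_eq_cylRadius_mul_swirlVelocity`: `Γ = r u^θ` off the axis). [new here — dictionary] -/
theorem abs_swirlVelocity_modulatedProfile_le {T ν V₀ M : ℝ} {v : ℝ → (EuclideanSpace ℝ (Fin 3)) → (EuclideanSpace ℝ (Fin 3))} {q : ℝ → (EuclideanSpace ℝ (Fin 3)) → ℝ}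
    (hν : 0 < ν) (hT : 0 < T) (hcl : IsClassicalNSSolutionOn (Icc 0 T) ν 0 v q)
    (haxi : ∀ t ∈ Icc 0 T, IsAxisymmetric (v t)) (hV : ∀ t ∈ Icc 0 T, ∀ x, ‖v t x‖ ≤ V₀)
    (hM : ∀ x, |swirl (v 0) x| ≤ M) {t : ℝ} (ht : t ∈ Icc 0 T) (lam : ℝ) {xc : (EuclideanSpace ℝ (Fin 3))} (hxc0 : xc 0 = 0)
    (hxc1 : xc 1 = 0) {y : (EuclideanSpace ℝ (Fin 3))} (hy : cylRadius y ≠ 0) :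
    |swirlVelocity (fun w => lam • v t (xc + lam • w)) y| ≤ M / cylRadius y := by
  have hr : 0 < cylRadius y := lt_of_le_of_ne (cylRadius_nonneg y) (Ne.symm hy)
  have h := abs_swirl_modulatedProfile_le hν hT hcl haxi hV hM ht lam hxc0 hxc1 y
  rw [swirl_eq_cylRadius_mul_swirlVelocity _ hy, abs_mul, abs_of_pos hr] at h
  rw [le_div_iff₀ hr, mul_comm]
  exact h

end Swirl

end TypeIIModulationDictionary
end Summit.NavierStokesRegularity.OSWSelfSimilar
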